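import Mathlib
import Literature.NumberTheory.LFunctions.Zhang2022.TypedSection15C
import Literature.NumberTheory.LFunctions.Zhang2022.Section15Eval1524
import Literature.NumberTheory.LFunctions.Zhang2022.Section15RhoProductsRate
import HarnessLib

/-!
# Zhang (2022) §15 p. 88: `ℛ₁*ℛ₁ⱼ = (1,2,1)ⱼ + O(𝓛⁻⁵)` from u058 and the RELATIVE form of u059
# (`ℛ₁ⱼ = Mⱼ(1 + O(𝓛⁻⁶))`), and the step to (15.24) along it

Topic `Literature/NumberTheory/LFunctions/Zhang2022` (Landau–Siegel audit tree; verdict-neutral).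
Y. Zhang, *Discrete mean estimates and the Landau–Siegel zero*, arXiv:2211.02515v1 (2022)
[Zhang2022LandauSiegel] — an unrefereed manuscript under adjudication (cell siegel-zhang, D-0069,
discharge lane, node `Skeleton.Ded1524`). The cell's GAP row G-d53-1 records that the printed value
u059, "`ℛ₁ⱼ = Mⱼ + O(1/𝓛³)`" with `Mⱼ = P₄^{β₃−βⱼ}/((β_{j+1}−βⱼ)(β_{j+2}−βⱼ)L′(1,χ))` of size
`|Mⱼ| ≍ 𝓛¹⁸/|L′(1,χ)|`, asserts an ABSOLUTE error where Lemma 5.8 and `ζ(1+u) = u⁻¹ + γ + O(u)`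
give only the RELATIVE one, `ℛ₁ⱼ = Mⱼ(1 + O(𝓛⁻⁶))`. This file shows that the relative form is all
the step to (15.24) needs: the companion `Section15RhoProductsRate.prod_rate5_of_values` (printed
u059) is re-proved here from

  `(u059-rel)  ‖ℛ₁ⱼ − Mⱼ‖ ≤ C‖Mⱼ‖𝓛⁻⁶`  (`1 ≤ j ≤ 3`),

with the same conclusion `ℛ₁*ℛ₁ⱼ = (1,2,1)ⱼ + O(𝓛⁻⁵)` (`prod_rate5_of_values_rel`): in the
decomposition `ℛ*ℛ − r₀s = (ℛ* − β₁β₂L′)ℛ + β₁β₂L′(ℛ − M) + (r·w − r₀s)` the middle term is now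
`≤ (C𝓛⁻⁶)·|β₁β₂L′M| = (C𝓛⁻⁶)·|β₁β₂/((β_{j+1}−βⱼ)(β_{j+2}−βⱼ))|`, in which `L′(1,χ)` cancels exactly
(`prod_bound_rel`). Then `eval1524_of_displays_rel`: (15.6) + (15.17) + (15.23) + u058 + (u059-rel) ⇒
`Skeleton.Eval1524 c′`, for the landed instantiation `Typed.Section15C.inputs15AB`.

WHAT THIS IS NOT: a proof of u058 or of (u059-rel) (the latter is sz-d53's discharge target for the
concrete residue `Typed.Section15B.calR1`), nor any claim about Theorems 1–2 or Landau–Siegel zeros.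

## References
* Y. Zhang, arXiv:2211.02515v1 (2022), §15 p. 88; §5 Lemma 5.8; §2 (2.13). [cite: Zhang2022LandauSiegel, §15 p.88]
-/

noncomputable section

open Complex Real ComplexConjugate
open Literature.NumberTheory.LFunctions.Zhang2022.Skeleton
open Literature.NumberTheory.LFunctions.Zhang2022.Typed

namespace Literature.NumberTheory.LFunctions.Zhang2022.Ded1524

/-! ## 1. One product, pointwise, with a RELATIVE error on `ℛ₁ⱼ` -/

/-- **Pointwise product bound, relative version.** As `prod_bound`, but with `‖ℛ − w/(dL)‖ ≤
E₂·‖w/(dL)‖`: then `‖ℛ*ℛ − r₀s‖ ≤ E₁(1 + E₂)·4/(a²m₀) + E₂(|r₀| + δ_r) + (δ_r + |r₀|δ_w)` — the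
factor `L` cancels in the middle term (`|ν||L||w/(dL)| = |ν/d| = |r|`).
[cite: Zhang2022LandauSiegel, §15 p.88] -/
theorem prod_bound_rel {Rs R L d w ν s : ℂ} {r r₀ E₁ E₂ a m₀ δr δw : ℝ}
    (ha : 0 < a) (hm₀ : 0 < m₀) (hL₀ : m₀ ≤ ‖L‖) (hd : a ^ 2 / 4 ≤ ‖d‖)
    (hratio : ν / d = (r : ℂ)) (hr : |r - r₀| ≤ δr)
    (hw1 : ‖w‖ = 1) (hws : ‖w - s‖ ≤ δw) (hE₂ : 0 ≤ E₂)
    (hRs : ‖Rs - ν * L‖ ≤ E₁) (hR : ‖R - w / (d * L)‖ ≤ E₂ * ‖w / (d * L)‖) :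
    ‖Rs * R - r₀ * s‖ ≤
      E₁ * (1 + E₂) * (4 / (a ^ 2 * m₀)) + E₂ * (|r₀| + δr) + (δr + |r₀| * δw) := by
  have hd0 : d ≠ 0 := by
    intro h; rw [h, norm_zero] at hd; nlinarith [pow_pos ha 2]
  have hL0 : L ≠ 0 := by
    intro h; rw [h, norm_zero] at hL₀; linarith
  have hE₁ : 0 ≤ E₁ := (norm_nonneg _).trans hRs
  have key : Rs * R - r₀ * s =
      (Rs - ν * L) * R + ν * L * (R - w / (d * L)) + ((r : ℂ) * w - r₀ * s) := by
    rw [← hratio]; field_simp; ring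
  have hM : ‖w / (d * L)‖ ≤ 4 / (a ^ 2 * m₀) := by
    rw [norm_div, norm_mul, hw1, div_le_div_iff₀ (by positivity) (by positivity)]
    calc 1 * (a ^ 2 * m₀) = 4 * (a ^ 2 / 4 * m₀) := by ring
      _ ≤ 4 * (‖d‖ * ‖L‖) := by gcongr
  have hRn : ‖R‖ ≤ (1 + E₂) * (4 / (a ^ 2 * m₀)) := by
    calc ‖R‖ = ‖w / (d * L) + (R - w / (d * L))‖ := by ring_nf
      _ ≤ ‖w / (d * L)‖ + ‖R - w / (d * L)‖ := norm_add_le _ _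
      _ ≤ ‖w / (d * L)‖ + E₂ * ‖w / (d * L)‖ := add_le_add le_rfl hR
      _ = (1 + E₂) * ‖w / (d * L)‖ := by ring
      _ ≤ (1 + E₂) * (4 / (a ^ 2 * m₀)) := by gcongr
  have hνLM : ‖ν‖ * ‖L‖ * ‖w / (d * L)‖ = |r| := by
    have : ν * L * (w / (d * L)) = (r : ℂ) * w := by rw [← hratio]; field_simp
    rw [← norm_mul, ← norm_mul, this, norm_mul, hw1, mul_one, Complex.norm_real, Real.norm_eq_abs]
  have hrabs : |r| ≤ |r₀| + δr := by
    calc |r| = |r₀ + (r - r₀)| := by ring_nf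
      _ ≤ |r₀| + |r - r₀| := abs_add_le _ _
      _ ≤ |r₀| + δr := by gcongr
  have h2 : ‖ν * L * (R - w / (d * L))‖ ≤ E₂ * (|r₀| + δr) := by
    rw [norm_mul, norm_mul]
    calc ‖ν‖ * ‖L‖ * ‖R - w / (d * L)‖ ≤ ‖ν‖ * ‖L‖ * (E₂ * ‖w / (d * L)‖) := by gcongr
      _ = E₂ * (‖ν‖ * ‖L‖ * ‖w / (d * L)‖) := by ring
      _ = E₂ * |r| := by rw [hνLM]
      _ ≤ E₂ * (|r₀| + δr) := by gcongr
  have h3 : ‖(r : ℂ) * w - r₀ * s‖ ≤ δr + |r₀| * δw := by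
    calc ‖(r : ℂ) * w - r₀ * s‖ = ‖((r - r₀ : ℝ) : ℂ) * w + r₀ * (w - s)‖ := by push_cast; ring_nf
      _ ≤ ‖((r - r₀ : ℝ) : ℂ) * w‖ + ‖(r₀ : ℂ) * (w - s)‖ := norm_add_le _ _
      _ = |r - r₀| * 1 + |r₀| * ‖w - s‖ := by
          rw [norm_mul, norm_mul, Complex.norm_real, Complex.norm_real, Real.norm_eq_abs,
            Real.norm_eq_abs, hw1]
      _ ≤ δr * 1 + |r₀| * δw := by gcongr
      _ = δr + |r₀| * δw := by ring
  rw [key]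
  calc ‖(Rs - ν * L) * R + ν * L * (R - w / (d * L)) + ((r : ℂ) * w - r₀ * s)‖
      ≤ ‖(Rs - ν * L) * R‖ + ‖ν * L * (R - w / (d * L))‖ + ‖(r : ℂ) * w - r₀ * s‖ :=
        (norm_add_le _ _).trans (by gcongr; exact norm_add_le _ _)
    _ ≤ E₁ * ((1 + E₂) * (4 / (a ^ 2 * m₀))) + E₂ * (|r₀| + δr) + (δr + |r₀| * δw) := by
        rw [norm_mul]
        gcongr
    _ = E₁ * (1 + E₂) * (4 / (a ^ 2 * m₀)) + E₂ * (|r₀| + δr) + (δr + |r₀| * δw) := by ring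

/-! ## 2. The eventual statement from u058 and (u059-rel) -/

/-- `log D ≥ M` once `D ≥ ⌈e^M⌉`. [folklore] -/
private theorem le_ell_of_ceil_exp_le_rel {M : ℝ} {D : ℕ} (hD : ⌈Real.exp M⌉₊ ≤ D) : M ≤ ell D := by
  have h : Real.exp M ≤ D := le_trans (Nat.le_ceil _) (by exact_mod_cast hD)
  exact (Real.le_log_iff_exp_le (lt_of_lt_of_le (Real.exp_pos _) h)).mpr h

/-- `β₁, …, β₅` by the index convention. [cite: Zhang2022LandauSiegel, §8 p.17] -/
private theorem betaJ_vals_rel (c' : ℝ) (D : ℕ) :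
    betaJ c' D 1 = beta1 c' D ∧ betaJ c' D 2 = beta2 c' D ∧ betaJ c' D 3 = beta3 c' D ∧
      betaJ c' D 4 = beta1 c' D ∧ betaJ c' D 5 = beta2 c' D := by
  simp [betaJ]

/-- Collecting the constants of the relative bound: every term is `≤ const·𝓛⁻⁵` (`𝓛 ≥ 1`,
`α = π𝓛⁻⁹`, `|θ| = |c′|π𝓛⁻⁸ ≤ 1/14`). [cite: Zhang2022LandauSiegel, §15 p.88] -/
theorem collect_rel {ℓ α m₀ C₁ C₂ c θa : ℝ} (hℓ : 1 ≤ ℓ) (hm₀ : 0 < m₀) (hα : α = π / ℓ ^ 9)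
    (hθa : θa = |c| * π / ℓ ^ 8) (hθs : θa ≤ 1 / 14) :
    |C₁| / ℓ ^ 24 * (1 + |C₂| / ℓ ^ 6) * (4 / (α ^ 2 * m₀)) + |C₂| / ℓ ^ 6 * (2 + 24 * θa) +
        (24 * θa + 2 * ((5 * |c| * (π + 521) + 1042) * (α * ℓ ^ 3))) ≤
      (4 * |C₁| * (1 + |C₂|) / (π ^ 2 * m₀) + 4 * |C₂| + 24 * |c| * π +
        2 * ((5 * |c| * (π + 521) + 1042) * π)) / ℓ ^ 5 := by
  have hℓ0 : 0 < ℓ := by linarith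
  have hα2 : α ^ 2 = π ^ 2 / ℓ ^ 18 := by rw [hα]; ring
  have i6 : 1 / ℓ ^ 6 ≤ 1 / ℓ ^ 5 :=
    one_div_le_one_div_of_le (by positivity) (pow_le_pow_right₀ hℓ (by norm_num))
  have i8 : 1 / ℓ ^ 8 ≤ 1 / ℓ ^ 5 :=
    one_div_le_one_div_of_le (by positivity) (pow_le_pow_right₀ hℓ (by norm_num))
  have hC26 : |C₂| / ℓ ^ 6 ≤ |C₂| := div_le_self (abs_nonneg _) (one_le_pow₀ hℓ)
  have t1 : |C₁| / ℓ ^ 24 * (1 + |C₂| / ℓ ^ 6) * (4 / (α ^ 2 * m₀)) ≤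
      4 * |C₁| * (1 + |C₂|) / (π ^ 2 * m₀) * (1 / ℓ ^ 6) := by
    have e : |C₁| / ℓ ^ 24 * (4 / (α ^ 2 * m₀)) = 4 * |C₁| / (π ^ 2 * m₀) * (1 / ℓ ^ 6) := by
      rw [hα2]; field_simp
    calc |C₁| / ℓ ^ 24 * (1 + |C₂| / ℓ ^ 6) * (4 / (α ^ 2 * m₀))
        = (1 + |C₂| / ℓ ^ 6) * (|C₁| / ℓ ^ 24 * (4 / (α ^ 2 * m₀))) := by ring
      _ ≤ (1 + |C₂|) * (4 * |C₁| / (π ^ 2 * m₀) * (1 / ℓ ^ 6)) := by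
          rw [e]; gcongr
      _ = 4 * |C₁| * (1 + |C₂|) / (π ^ 2 * m₀) * (1 / ℓ ^ 6) := by ring
  have t2 : |C₂| / ℓ ^ 6 * (2 + 24 * θa) ≤ 4 * |C₂| * (1 / ℓ ^ 6) := by
    have : 2 + 24 * θa ≤ 4 := by linarith
    calc |C₂| / ℓ ^ 6 * (2 + 24 * θa) ≤ |C₂| / ℓ ^ 6 * 4 := by gcongr
      _ = 4 * |C₂| * (1 / ℓ ^ 6) := by ring
  have t4 : 24 * θa = 24 * |c| * π * (1 / ℓ ^ 8) := by rw [hθa]; ring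
  have t5 : α * ℓ ^ 3 = π * (1 / ℓ ^ 6) := by rw [hα]; field_simp
  have eW : 2 * ((5 * |c| * (π + 521) + 1042) * (π * (1 / ℓ ^ 6))) =
      2 * ((5 * |c| * (π + 521) + 1042) * π) * (1 / ℓ ^ 6) := by ring
  have j6a := mul_le_mul_of_nonneg_left i6 (by positivity : (0:ℝ) ≤ 4 * |C₁| * (1 + |C₂|) / (π ^ 2 * m₀))
  have j6b := mul_le_mul_of_nonneg_left i6 (by positivity : (0:ℝ) ≤ 4 * |C₂|)
  have j8 := mul_le_mul_of_nonneg_left i8 (by positivity : (0:ℝ) ≤ 24 * |c| * π)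
  have jW := mul_le_mul_of_nonneg_left i6
    (by positivity : (0:ℝ) ≤ 2 * ((5 * |c| * (π + 521) + 1042) * π))
  have t45 : 24 * θa + 2 * ((5 * |c| * (π + 521) + 1042) * (α * ℓ ^ 3)) =
      24 * |c| * π * (1 / ℓ ^ 8) + 2 * ((5 * |c| * (π + 521) + 1042) * π) * (1 / ℓ ^ 6) := by
    rw [t4, t5, eW]
  rw [t45, div_eq_mul_one_div _ (ℓ ^ 5)]
  linarith

/-- The three tails of `prod_bound_rel` at `(r₀, s, δ) = (1,1,·), (−2,−1,·), (1,1,0)` are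
dominated by one common tail. [cite: Zhang2022LandauSiegel, §15 p.88] -/
private theorem tails_le {E θ₀ A c : ℝ} (hE : 0 ≤ E) (hθ₀ : 0 ≤ θ₀) (hA : 0 ≤ A) :
    E * (|(1:ℝ)| + 24 * θ₀) + (24 * θ₀ + |(1:ℝ)| * ((2 * |c| * (π + 521) + 1042) * A)) ≤
        E * (2 + 24 * θ₀) + (24 * θ₀ + 2 * ((5 * |c| * (π + 521) + 1042) * A)) ∧
      E * (|(-2:ℝ)| + 24 * θ₀) + (24 * θ₀ + |(-2:ℝ)| * ((5 * |c| * (π + 521) + 521) * A)) ≤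
        E * (2 + 24 * θ₀) + (24 * θ₀ + 2 * ((5 * |c| * (π + 521) + 1042) * A)) ∧
      E * (|(1:ℝ)| + 0) + (0 + |(1:ℝ)| * 0) ≤
        E * (2 + 24 * θ₀) + (24 * θ₀ + 2 * ((5 * |c| * (π + 521) + 1042) * A)) := by
  have hcπ : 0 ≤ |c| * (π + 521) := mul_nonneg (abs_nonneg c) (by positivity)
  rw [abs_one, show |(-2:ℝ)| = 2 by norm_num]
  have e1 : E * (1 + 24 * θ₀) ≤ E * (2 + 24 * θ₀) := mul_le_mul_of_nonneg_left (by linarith) hE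
  have e3 : E * (1 + 0) ≤ E * (2 + 24 * θ₀) := mul_le_mul_of_nonneg_left (by linarith) hE
  have c1 : (2 * |c| * (π + 521) + 1042) * A ≤ 2 * ((5 * |c| * (π + 521) + 1042) * A) := by
    nlinarith
  have c2 : 2 * ((5 * |c| * (π + 521) + 521) * A) ≤ 2 * ((5 * |c| * (π + 521) + 1042) * A) := by
    nlinarith
  have c3 : (0:ℝ) ≤ 24 * θ₀ + 2 * ((5 * |c| * (π + 521) + 1042) * A) := by positivity
  refine ⟨by linarith, by linarith, by linarith⟩

/-- **`ℛ₁*ℛ₁ⱼ = (1,2,1)ⱼ + O(𝓛⁻⁵)` from u058 and the RELATIVE value of `ℛ₁ⱼ`** (`‖ℛ₁ⱼ − Mⱼ‖ ≤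
C‖Mⱼ‖/𝓛⁶`, the surviving form of u059 per the cell's row G-d53-1), for ANY families `ℛ₁*(D,χ)`,
`ℛ₁ⱼ(D,χ)`. [cite: Zhang2022LandauSiegel, §15 p.88] -/
theorem prod_rate5_of_values_rel (c' : ℝ)
    {R : ∀ (D : ℕ) [NeZero D], DirichletCharacter ℂ D → ℕ → ℂ}
    {Rs : ∀ (D : ℕ) [NeZero D], DirichletCharacter ℂ D → ℂ}
    (h58 : ∃ C : ℝ, ForAllLarge fun D _ χ => AssumptionA D χ →
      ‖Rs D χ - beta1 c' D * beta2 c' D * deriv χ.LFunction 1‖ ≤ C / ell D ^ 24)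
    (h59rel : ∃ C : ℝ, ForAllLarge fun D _ χ => AssumptionA D χ → ∀ j ∈ ({1, 2, 3} : Finset ℕ),
      ‖R D χ j - ((P4 D : ℝ) : ℂ) ^ (beta3 c' D - betaJ c' D j) /
        ((betaJ c' D (j + 1) - betaJ c' D j) * (betaJ c' D (j + 2) - betaJ c' D j) *
          deriv χ.LFunction 1)‖ ≤
        C * ‖((P4 D : ℝ) : ℂ) ^ (beta3 c' D - betaJ c' D j) /
          ((betaJ c' D (j + 1) - betaJ c' D j) * (betaJ c' D (j + 2) - betaJ c' D j) *
            deriv χ.LFunction 1)‖ / ell D ^ 6) :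
    ∃ C : ℝ, ForAllLarge fun D _ χ => AssumptionA D χ →
      ‖Rs D χ * R D χ 1 - 1‖ ≤ C / ell D ^ 5 ∧ ‖Rs D χ * R D χ 2 - 2‖ ≤ C / ell D ^ 5 ∧
        ‖Rs D χ * R D χ 3 - 1‖ ≤ C / ell D ^ 5 := by
  obtain ⟨C₁, h58⟩ := h58
  obtain ⟨C₂, h59⟩ := h59rel
  obtain ⟨a₀, ha₀, hA⟩ := frakALowerBound_holds
  set m₀ : ℝ := Real.sqrt a₀ with hm₀
  have hm₀pos : 0 < m₀ := Real.sqrt_pos.mpr ha₀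
  set K : ℝ := 4 * |C₁| * (1 + |C₂|) / (π ^ 2 * m₀) + 4 * |C₂| + 24 * |c'| * π +
    2 * ((5 * |c'| * (π + 521) + 1042) * π) with hK
  set M : ℝ := max 3 (14 * |c'| * π + 1) with hM
  have hT : ForAllLarge fun D _ _ => M ≤ ell D :=
    ForAllLarge.of_le ⌈Real.exp M⌉₊ fun D _ _ hD _ _ => le_ell_of_ceil_exp_le_rel hD
  obtain ⟨D₀, h⟩ := ((h58.and h59).and hA).and hT
  refine ⟨K, D₀, fun D _ χ hD hq hp hAss => ?_⟩
  obtain ⟨⟨⟨e58, e59⟩, eA⟩, hMℓ⟩ := h D χ hD hq hp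
  have g58 := e58 hAss
  have g59 := e59 hAss
  have gA := eA hAss
  have hℓ3 : 3 ≤ ell D := (le_max_left _ _).trans hMℓ
  have hℓc : 14 * |c'| * π + 1 ≤ ell D := (le_max_right _ _).trans hMℓ
  have hℓ2 : 2 ≤ ell D := by linarith
  have hℓ1 : 1 ≤ ell D := by linarith
  have hℓ0 : 0 < ell D := by linarith
  obtain ⟨hα0, -, -⟩ := alpha_bounds hℓ2
  have hα : alpha D = π / ell D ^ 9 := by rw [alpha, bigP, Real.log_exp]
  have hαpos : 0 < alpha D := by rw [hα]; positivity
  have hθabs : |c' * alpha D * ell D| = |c'| * π / ell D ^ 8 := by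
    rw [abs_mul, abs_mul, abs_of_nonneg hα0, abs_of_nonneg hℓ0.le, hα]; field_simp
  have hθ : |c' * alpha D * ell D| ≤ 1 / 14 := by
    rw [hθabs, div_le_div_iff₀ (by positivity) (by norm_num)]
    have h8 : ell D ≤ ell D ^ 8 := by
      calc ell D = ell D ^ 1 := (pow_one _).symm
        _ ≤ ell D ^ 8 := pow_le_pow_right₀ hℓ1 (by norm_num)
    nlinarith [abs_nonneg c', Real.pi_pos]
  have hθ' := abs_le.mp hθ
  have h1θ : 1 + c' * alpha D * ell D ≠ 0 := by intro h; linarith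
  have h5θ : 1 - 5 * (c' * alpha D * ell D) ≠ 0 := by intro h; linarith
  have h7θ : 1 + 7 * (c' * alpha D * ell D) ≠ 0 := by intro h; linarith
  set L : ℂ := deriv χ.LFunction 1 with hLdef
  have hLlow : m₀ ≤ ‖L‖ := sqrt_le_norm_deriv_of_frakA_ge χ gA
  obtain ⟨hν, hd1, hd2, hd3⟩ := beta_sizes c' D hα0 hθ
  obtain ⟨r1, r2, r3⟩ := beta_ratios c' D hαpos.ne' h1θ h5θ h7θ
  obtain ⟨bJ1, bJ2, bJ3, bJ4, bJ5⟩ := betaJ_vals_rel c' D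
  obtain ⟨w1, w2, w1n, w2n⟩ := P4_phases c' hℓ2
  obtain ⟨hr1, hr2⟩ := ratio_devs hθ
  have g1 := g59 1 (by simp)
  have g2 := g59 2 (by simp)
  have g3 := g59 3 (by simp)
  rw [show (1:ℕ) + 1 = 2 from rfl, show (1:ℕ) + 2 = 3 from rfl, bJ1, bJ2, bJ3] at g1
  rw [show (2:ℕ) + 1 = 3 from rfl, show (2:ℕ) + 2 = 4 from rfl, bJ2, bJ3, bJ4] at g2
  rw [show (3:ℕ) + 1 = 4 from rfl, show (3:ℕ) + 2 = 5 from rfl, bJ3, bJ4, bJ5, sub_self,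
    Complex.cpow_zero] at g3
  have hE1 : ‖Rs D χ - beta1 c' D * beta2 c' D * L‖ ≤ |C₁| / ell D ^ 24 :=
    g58.trans (by gcongr; exact le_abs_self C₁)
  have hE2 : 0 ≤ |C₂| / ell D ^ 6 := by positivity
  have e2 : ∀ (x : ℝ) (M : ℂ), x ≤ C₂ * ‖M‖ / ell D ^ 6 → x ≤ |C₂| / ell D ^ 6 * ‖M‖ := by
    intro x M hx
    refine hx.trans ?_
    rw [div_mul_eq_mul_div]
    gcongr
    exact le_abs_self C₂
  have P1 := prod_bound_rel (r₀ := 1) (s := 1) hαpos hm₀pos hLlow hd1 r1 hr1 w1n w1 hE2 hE1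
    (e2 _ _ g1)
  have P2 := prod_bound_rel (r₀ := -2) (s := -1) hαpos hm₀pos hLlow hd2 r2 hr2 w2n w2 hE2 hE1
    (e2 _ _ g2)
  have hr3 : beta1 c' D * beta2 c' D / ((beta1 c' D - beta3 c' D) * (beta2 c' D - beta3 c' D)) =
      ((1 : ℝ) : ℂ) := by rw [r3]; norm_num
  have z1 : |(1 : ℝ) - 1| ≤ 0 := by simp
  have z2 : ‖(1 : ℂ)‖ = 1 := by simp
  have z3 : ‖(1 : ℂ) - 1‖ ≤ 0 := by simp
  have P3 := prod_bound_rel (Rs := Rs D χ) (R := R D χ 3) (L := L)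
    (d := (beta1 c' D - beta3 c' D) * (beta2 c' D - beta3 c' D)) (w := 1)
    (ν := beta1 c' D * beta2 c' D) (s := 1) (r := 1) (r₀ := 1) (δr := 0) (δw := 0)
    hαpos hm₀pos hLlow hd3 hr3 z1 z2 z3 hE2 hE1 (e2 _ _ g3)
  have hcol := collect_rel (C₁ := C₁) (C₂ := C₂) hℓ1 hm₀pos hα hθabs (hθabs ▸ hθ)
  rw [← hK] at hcol
  -- each tail is dominated by the common one
  have hαℓ3 : 0 ≤ alpha D * ell D ^ 3 := by positivity
  have hθ0 : 0 ≤ |c' * alpha D * ell D| := abs_nonneg _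
  obtain ⟨tl1, tl2, tl3⟩ := tails_le (c := c') hE2 hθ0 hαℓ3
  rw [add_assoc] at hcol
  refine ⟨?_, ?_, ?_⟩
  · have e : ((1:ℝ) : ℂ) * 1 = 1 := by simp
    rw [e, add_assoc] at P1
    exact P1.trans ((add_le_add le_rfl tl1).trans hcol)
  · have e : ((-2:ℝ) : ℂ) * (-1) = 2 := by push_cast; ring
    rw [e, add_assoc] at P2
    exact P2.trans ((add_le_add le_rfl tl2).trans hcol)
  · have e : ((1:ℝ) : ℂ) * 1 = 1 := by simp
    rw [e, add_assoc] at P3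
    exact P3.trans ((add_le_add le_rfl tl3).trans hcol)

/-! ## 3. The step to (15.24) along the relative value of `ℛ₁ⱼ` -/

/-- **(15.24) from the typed displays (15.6), (15.17), (15.23), u058 and the RELATIVE form of u059**
(instance `inputs15AB`, printed coefficient reading). [cite: Zhang2022LandauSiegel, §15 (15.24) p.88] -/
theorem eval1524_of_displays_rel (c' : ℝ) (h6 : Section15A.Eq15_6 c' Section15A.bLit)
    (h17 : Section15B.Eq15_17 c' Section15A.bLit)
    (h23 : Section15C.Eq15_23 c' Section15C.inputs15AB)
    (h58 : Section15C.Step15_u058 c' Section15C.inputs15AB)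
    (h59rel : ∃ C : ℝ, ForAllLarge fun D _ χ => AssumptionA D χ → ∀ j ∈ ({1, 2, 3} : Finset ℕ),
      ‖Section15B.calR1 c' χ j - ((P4 D : ℝ) : ℂ) ^ (beta3 c' D - betaJ c' D j) /
        ((betaJ c' D (j + 1) - betaJ c' D j) * (betaJ c' D (j + 2) - betaJ c' D j) *
          deriv χ.LFunction 1)‖ ≤
        C * ‖((P4 D : ℝ) : ℂ) ^ (beta3 c' D - betaJ c' D j) /
          ((betaJ c' D (j + 1) - betaJ c' D j) * (betaJ c' D (j + 2) - betaJ c' D j) *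
            deriv χ.LFunction 1)‖ / ell D ^ 6) :
    Eval1524 c' :=
  eval1524_of_rates
    (Φp := fun D _ χ p => Section15A.Phi1pOf c' χ (Section15A.bLit D χ) p)
    (S := fun D _ χ j => Section15B.calS1 c' χ (Section15A.bLit D χ) j)
    (R := fun _ _ χ j => Section15B.calR1 c' χ j)
    (Rs := fun _ _ χ => Section15A.calR1star c' χ)
    h6 h17 h23 (prod_rate5_of_values_rel c' h58 h59rel)

end Literature.NumberTheory.LFunctions.Zhang2022.Ded1524
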